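import Literature.AlgebraicGeometry.Frobenioids.OneUniqueSquareFunctoriality
import Literature.AlgebraicGeometry.Frobenioids.Cor411ModelFrobenioid
import Literature.IUT.HodgeTheaters.ConventionsCatIsomorphismGroup
import Literature.IUT.HodgeTheaters.GlobalFrobenioidsArithmeticPullback
import HarnessLib

/-!
# [IUTchI] Cor. 5.3 (i): the natural map `Isom(¹ℱ^⊛, ²ℱ^⊛) → Isom(Base(¹ℱ^⊛), Base(²ℱ^⊛))` is REAL at the
# model global Frobenioids — [FrdI] Cor. 4.11 (ii) on equivalences, knitted to the §0 "isomorphisms"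

S. Mochizuki, *Inter-universal Teichmüller theory I*, kurims manuscript (May 2020), Cor. 5.3 (i) p. 144: "the
natural map `Isom(¹ℱ^⊛, ²ℱ^⊛) → Isom(Base(¹ℱ^⊛), Base(²ℱ^⊛))` [cf. [FrdI], Corollary 4.11; [FrdI], Theorem 6.4, (i);
Remark 3.1.5 of the present paper] … is bijective" ([IUTchI] Cor 5.3 (i) p.144) [claim: Mochizuki2012, status:
disputed] (D-0012 claim key, status DISPUTED — nothing of the series is asserted here; no side is taken on
[IUTchIII] Cor. 3.12).  The words "the natural map" presuppose that every equivalence `Ψ : ¹ℱ^⊛ ⥲ ²ℱ^⊛` induces an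
equivalence `Ψ^Base` of base categories, well defined on isomorphism classes ([IUTchI] §0 p. 33) and compatible
with composition — i.e. [FrdI] Cor. 4.11 (ii) "a `1`-unique functor `Ψ^Base : D₁ → D₂`"
[cite: MochizukiFrdI2008, Cor. 4.11 (ii) p.91].

PROOF-ONLY knit (cell abc-iut, seat abc-iut-L6-t7; row «C53i/M2 COR411-BASE-ON-EQUIV-AT-GLOBAL-MODEL» of
abc-iut-L5-t4's `SUBDAG-IUTchI-Cor53.md` §R/§T, merge object (m2) of the hub line for `IUTchI:Cor5.3(i)`), BY NAME
over: abc-iut-L1-t14's `ModelFrobenioid.exists_oneUniqueSquare_base_model` ([FrdI] Cor. 4.11 (ii) at model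
Frobenioids over slim FSMFF bases, `Cor411ModelFrobenioid.lean`); abc-iut-L6-t7's square algebra
`PreFrobenioidData.OneUniqueSquare.of_equiv_top/of_iso_sides/of_equiv_bot/nonempty_iso`
(`OneUniqueSquareFunctoriality.lean`); abc-iut-L5-t4's §0 "isomorphisms of categories" with the binders
`CatIsomorphism.HasUnder` / `UnderUnique` under which the natural map `CatIsomorphism.descend` and its laws
`descend_comp` / `descend_refl` / `descendHom` exist (`ConventionsCatIsomorphismGroup.lean`); abc-iut-L5-t1's REAL
records `GlobalDivisorData G` (`ℱ^⊛(†𝒟^⊚) = ModelFrobenioid Δ.Φ Δ.B Δ.div` over `†𝒟^⊛ = ℬ(G)⁰ = BaseCat G`) and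
`GlobalFrobenioid Δ Dcirc toBase0` (an isomorph `†ℱ^⊛` with `equiv : †ℱ^⊛ ≌ ℱ^⊛(†𝒟^⊚)`, `toBase`,
`identify : Base(†ℱ^⊛) ≌ †𝒟^⊛`, `toBase_compat`) (`GlobalFrobenioidsModel.lean`); abc-iut-w4-d050's
`isOfFSMType_baseCat` (`GlobalFrobenioidsArithmeticPullback.lean`).

* `CatIsomorphism.hasUnder_of_forall_oneUniqueSquare` / `underUnique_of_forall_oneUniqueSquare` — generic: a
  supply of `1`-unique base squares for every `Ψ` IS the pair of binders (`HasUnder`, `UnderUnique`), so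
  `descend : Isom(C₁, C₂) → Isom(D₁, D₂)` is defined and functorial; `descend_mk_of_oneUniqueSquare` — it sends
  the class of `Ψ` to the class of the bottom functor of any `1`-unique square over `Ψ`;
* `GlobalDivisorData.exists_oneUniqueSquare_modelBase`, `hasUnder_modelBase`, `underUnique_modelBase` — at the
  bare models `ℱ^⊛(†𝒟^⊚)` over `ℬ(G_i)⁰` (FSMFF-type discharged; the other [FrdI] hypotheses BY NAME, see below);
* `GlobalFrobenioid.exists_oneUniqueSquare_toBase`, `hasUnder_toBase`, `underUnique_toBase` — at abc-iut-L5-t1's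
  isomorph records `ⁱℱ^⊛` with THEIR base functors `ⁱℱ^⊛ → Base(ⁱℱ^⊛)`, transported along `equiv`, `toBase_compat`,
  `identify`.

HONEST RESIDUAL (displayed binders, not discharged here): the [FrdI] Thm. 5.2 hypotheses `ModelFrobenioid.Hypotheses
Δ.Φ Δ.B` (as in abc-iut-w4-d050's `GlobalDivisorData.isFrobenioid_model`), `Φ^⊛` perf-factorial ([FrdI] §4
standing assumption), non-dilating and not the zero monoid ([FrdI] Thm. 5.2 (iii)), and `IsSlim (BaseCat G)`
(slim ⇒ Div-slim, [FrdI] Def. 4.5 (iv); for `G = G_F` an anabelian input).  With these, what is left of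
Cor. 5.3 (i) is exactly abc-iut-L5-t4's `CatIsomorphism.DescendBijective` at the model = the category-theoreticity of
`𝕄^⊛(†𝒟^⊚) ⥲ †𝕄^⊛` (Ex. 5.1 (v)); the `†ℱ^⊚` twin wants the standard type of `†ℱ^⊚` (not in the tree).  No new
definitions; nothing of the series is asserted; nothing here bears on [IUTchIII] Cor. 3.12.
-/

namespace Literature.IUT.HodgeTheaters

open CategoryTheory Literature.AlgebraicGeometry.Frobenioids

universe v₁ v₂ v₃ v₄ u₁ u₂ u₃ u₄ u

/-! ### `1`-unique base squares ⇒ the binders of the natural map `Isom(C₁, C₂) → Isom(D₁, D₂)` -/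

namespace CatIsomorphism

section OfOneUniqueSquare

variable {C₁ : Type u₁} [Category.{v₁} C₁] {C₂ : Type u₂} [Category.{v₂} C₂]
  {D₁ : Type u₃} [Category.{v₃} D₁] {D₂ : Type u₄} [Category.{v₄} D₂] {p₁ : C₁ ⥤ D₁} {p₂ : C₂ ⥤ D₂}

/-- **Existence binder from `1`-unique squares**: if under every `Ψ : C₁ ⥲ C₂` there is a `1`-unique
`1`-commutative square `Ψ ⋙ p₂ ≅ p₁ ⋙ Ψ^Base` ([FrdI] Cor. 4.11 (ii)), then `HasUnder p₁ p₂` — the bottom functor is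
an equivalence lying under `Ψ`. ([IUTchI] Cor 5.3 (i) p.144) [claim: Mochizuki2012, status: disputed] -/
theorem hasUnder_of_forall_oneUniqueSquare
    (h : ∀ Ψ : C₁ ≌ C₂, ∃ B : D₁ ⥤ D₂, PreFrobenioidData.OneUniqueSquare Ψ.functor p₁ p₂ B) :
    HasUnder p₁ p₂ := by
  intro Ψ
  obtain ⟨B, hB⟩ := h Ψ
  haveI := hB.isEquivalence
  exact ⟨B.asEquivalence, ⟨hB.oneCommutes.some⟩⟩

/-- **Uniqueness binder from `1`-unique squares**: two equivalences lying under the same `Ψ` are both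
isomorphic to the `1`-unique `Ψ^Base`, hence to each other — `UnderUnique p₁ p₂`.
([IUTchI] Cor 5.3 (i) p.144) [claim: Mochizuki2012, status: disputed] -/
theorem underUnique_of_forall_oneUniqueSquare
    (h : ∀ Ψ : C₁ ≌ C₂, ∃ B : D₁ ⥤ D₂, PreFrobenioidData.OneUniqueSquare Ψ.functor p₁ p₂ B) :
    UnderUnique p₁ p₂ := by
  intro Ψ Θ Θ' hΘ hΘ'
  obtain ⟨i⟩ := hΘ
  obtain ⟨i'⟩ := hΘ'
  obtain ⟨B, hB⟩ := h Ψ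
  obtain ⟨j⟩ := hB.nonempty_iso (B' := Θ.functor) ⟨i⟩
  obtain ⟨j'⟩ := hB.nonempty_iso (B' := Θ'.functor) ⟨i'⟩
  exact ⟨j ≪≫ j'.symm⟩

/-- **The natural map on a class is the class of `Ψ^Base`**: under the binders, `descend [Ψ] = [B]` for the
bottom functor `B` of ANY `1`-unique square over `Ψ` (abc-iut-L5-t4's `descend_mk`).
([IUTchI] Cor 5.3 (i) p.144) [claim: Mochizuki2012, status: disputed] -/
theorem descend_mk_of_oneUniqueSquare (he : HasUnder p₁ p₂) (hu : UnderUnique p₁ p₂) {Ψ : C₁ ≌ C₂}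
    {B : D₁ ⥤ D₂} (hB : PreFrobenioidData.OneUniqueSquare Ψ.functor p₁ p₂ B) [B.IsEquivalence] :
    descend he hu (CatIsomorphism.mk Ψ) = CatIsomorphism.mk B.asEquivalence :=
  descend_mk he hu ⟨hB.oneCommutes.some⟩

end OfOneUniqueSquare

end CatIsomorphism

/-! ### At the bare models `ℱ^⊛(†𝒟^⊚)` over `†𝒟^⊛ = ℬ(G)⁰` -/

namespace GlobalDivisorData

variable {G₁ G₂ : ProfiniteGrp.{u}} (Δ₁ : GlobalDivisorData G₁) (Δ₂ : GlobalDivisorData G₂)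

/-- **[FrdI] Cor. 4.11 (ii) at the model global Frobenioids**: for EVERY equivalence
`Ψ : ℱ^⊛(¹𝒟^⊚) ⥲ ℱ^⊛(²𝒟^⊚)` there is a `1`-unique `Ψ^Base : ℬ(G₁)⁰ ⥲ ℬ(G₂)⁰` under `Ψ` with both `ℬ(G₂)⁰`-valued
composites rigid — abc-iut-L1-t14's `ModelFrobenioid.exists_oneUniqueSquare_base_model` with "`ℬ(G)⁰` of
FSMFF-type" DISCHARGED (abc-iut-w4-d050's `isOfFSMType_baseCat`), the remaining [FrdI] hypotheses displayed.
([IUTchI] Cor 5.3 (i) p.144) [claim: Mochizuki2012, status: disputed] -/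
theorem exists_oneUniqueSquare_modelBase (h₁ : ModelFrobenioid.Hypotheses Δ₁.Φ Δ₁.B)
    (h₂ : ModelFrobenioid.Hypotheses Δ₂.Φ Δ₂.B)
    (hpf₁ : Objectwise (fun M _ => IsPerfFactorial M) Δ₁.Φ) (hpf₂ : Objectwise (fun M _ => IsPerfFactorial M) Δ₂.Φ)
    (hsl₁ : IsSlim (BaseCat G₁)) (hsl₂ : IsSlim (BaseCat G₂))
    (hnd₁ : IsNonDilatingOn Δ₁.Φ) (hnd₂ : IsNonDilatingOn Δ₂.Φ)
    (hz₁ : ¬ ModelFrobenioid.IsZeroMonoid Δ₁.Φ) (hz₂ : ¬ ModelFrobenioid.IsZeroMonoid Δ₂.Φ)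
    (Ψ : Δ₁.ModelGlobalFrobenioid ≌ Δ₂.ModelGlobalFrobenioid) :
    ∃ ΨBase : BaseCat G₁ ⥤ BaseCat G₂,
      PreFrobenioidData.OneUniqueSquare Ψ.functor Δ₁.modelBase Δ₂.modelBase ΨBase ∧
        IsRigidFunctor (Ψ.functor ⋙ Δ₂.modelBase) ∧ IsRigidFunctor (Δ₁.modelBase ⋙ ΨBase) :=
  ModelFrobenioid.exists_oneUniqueSquare_base_model h₁ h₂ hpf₁ hpf₂ hsl₁ hsl₂
    (isOfFSMType_baseCat G₁).isOfFSMFFType (isOfFSMType_baseCat G₂).isOfFSMFFType hnd₁ hnd₂ hz₁ hz₂ Ψ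

/-- **`HasUnder` at the model global Frobenioids**: under every `Ψ : ℱ^⊛(¹𝒟^⊚) ⥲ ℱ^⊛(²𝒟^⊚)` lies an
equivalence `ℬ(G₁)⁰ ⥲ ℬ(G₂)⁰` (same displayed hypotheses). ([IUTchI] Cor 5.3 (i) p.144) [claim: Mochizuki2012, status: disputed] -/
theorem hasUnder_modelBase (h₁ : ModelFrobenioid.Hypotheses Δ₁.Φ Δ₁.B) (h₂ : ModelFrobenioid.Hypotheses Δ₂.Φ Δ₂.B)
    (hpf₁ : Objectwise (fun M _ => IsPerfFactorial M) Δ₁.Φ) (hpf₂ : Objectwise (fun M _ => IsPerfFactorial M) Δ₂.Φ)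
    (hsl₁ : IsSlim (BaseCat G₁)) (hsl₂ : IsSlim (BaseCat G₂))
    (hnd₁ : IsNonDilatingOn Δ₁.Φ) (hnd₂ : IsNonDilatingOn Δ₂.Φ)
    (hz₁ : ¬ ModelFrobenioid.IsZeroMonoid Δ₁.Φ) (hz₂ : ¬ ModelFrobenioid.IsZeroMonoid Δ₂.Φ) :
    CatIsomorphism.HasUnder Δ₁.modelBase Δ₂.modelBase :=
  CatIsomorphism.hasUnder_of_forall_oneUniqueSquare fun Ψ =>
    let ⟨B, hB, _⟩ := exists_oneUniqueSquare_modelBase Δ₁ Δ₂ h₁ h₂ hpf₁ hpf₂ hsl₁ hsl₂ hnd₁ hnd₂ hz₁ hz₂ Ψ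
    ⟨B, hB⟩

/-- **`UnderUnique` at the model global Frobenioids**: the equivalence of base categories under `Ψ` is unique up
to isomorphism (same displayed hypotheses). ([IUTchI] Cor 5.3 (i) p.144) [claim: Mochizuki2012, status: disputed] -/
theorem underUnique_modelBase (h₁ : ModelFrobenioid.Hypotheses Δ₁.Φ Δ₁.B)
    (h₂ : ModelFrobenioid.Hypotheses Δ₂.Φ Δ₂.B)
    (hpf₁ : Objectwise (fun M _ => IsPerfFactorial M) Δ₁.Φ) (hpf₂ : Objectwise (fun M _ => IsPerfFactorial M) Δ₂.Φ)
    (hsl₁ : IsSlim (BaseCat G₁)) (hsl₂ : IsSlim (BaseCat G₂))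
    (hnd₁ : IsNonDilatingOn Δ₁.Φ) (hnd₂ : IsNonDilatingOn Δ₂.Φ)
    (hz₁ : ¬ ModelFrobenioid.IsZeroMonoid Δ₁.Φ) (hz₂ : ¬ ModelFrobenioid.IsZeroMonoid Δ₂.Φ) :
    CatIsomorphism.UnderUnique Δ₁.modelBase Δ₂.modelBase :=
  CatIsomorphism.underUnique_of_forall_oneUniqueSquare fun Ψ =>
    let ⟨B, hB, _⟩ := exists_oneUniqueSquare_modelBase Δ₁ Δ₂ h₁ h₂ hpf₁ hpf₂ hsl₁ hsl₂ hnd₁ hnd₂ hz₁ hz₂ Ψ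
    ⟨B, hB⟩

end GlobalDivisorData

/-! ### At the isomorphs `ⁱℱ^⊛` (abc-iut-L5-t1's `GlobalFrobenioid` records) with their base functors -/

namespace GlobalFrobenioid

variable {G₁ G₂ : ProfiniteGrp.{u}} {Δ₁ : GlobalDivisorData G₁} {Δ₂ : GlobalDivisorData G₂}
  {Dcirc₁ : Type (u + 1)} [Category.{u} Dcirc₁] {toBase0₁ : Dcirc₁ ⥤ BaseCat G₁}
  {Dcirc₂ : Type (u + 1)} [Category.{u} Dcirc₂] {toBase0₂ : Dcirc₂ ⥤ BaseCat G₂}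
  (F₁ : GlobalFrobenioid Δ₁ Dcirc₁ toBase0₁) (F₂ : GlobalFrobenioid Δ₂ Dcirc₂ toBase0₂)

/-- **[FrdI] Cor. 4.11 (ii) at isomorphs `ⁱℱ^⊛` of the model global Frobenioids**: for EVERY equivalence
`Ψ : ¹ℱ^⊛ ⥲ ²ℱ^⊛` there is a `1`-unique `Ψ^Base : Base(¹ℱ^⊛) ⥲ Base(²ℱ^⊛)` with `Ψ ⋙ Base₂ ≅ Base₁ ⋙ Ψ^Base` — the
model square of `equiv₁⁻¹ ∘ Ψ ∘ equiv₂` transported along `equiv_i` (top corners), `toBase_compat_i` (sides) and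
`identify_i` (bottom corners); same displayed hypotheses. ([IUTchI] Cor 5.3 (i) p.144) [claim: Mochizuki2012, status: disputed] -/
theorem exists_oneUniqueSquare_toBase (h₁ : ModelFrobenioid.Hypotheses Δ₁.Φ Δ₁.B)
    (h₂ : ModelFrobenioid.Hypotheses Δ₂.Φ Δ₂.B)
    (hpf₁ : Objectwise (fun M _ => IsPerfFactorial M) Δ₁.Φ) (hpf₂ : Objectwise (fun M _ => IsPerfFactorial M) Δ₂.Φ)
    (hsl₁ : IsSlim (BaseCat G₁)) (hsl₂ : IsSlim (BaseCat G₂))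
    (hnd₁ : IsNonDilatingOn Δ₁.Φ) (hnd₂ : IsNonDilatingOn Δ₂.Φ)
    (hz₁ : ¬ ModelFrobenioid.IsZeroMonoid Δ₁.Φ) (hz₂ : ¬ ModelFrobenioid.IsZeroMonoid Δ₂.Φ)
    (Ψ : F₁.cat ≌ F₂.cat) :
    ∃ ΨBase : F₁.Base ⥤ F₂.Base, PreFrobenioidData.OneUniqueSquare Ψ.functor F₁.toBase F₂.toBase ΨBase := by
  -- the model square of `Ψ' := equiv₁⁻¹ ⋙ Ψ ⋙ equiv₂`
  obtain ⟨B, hB, -⟩ := Δ₁.exists_oneUniqueSquare_modelBase Δ₂ h₁ h₂ hpf₁ hpf₂ hsl₁ hsl₂ hnd₁ hnd₂ hz₁ hz₂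
    (F₁.equiv.symm.trans (Ψ.trans F₂.equiv))
  -- top corners: back to `ⁱℱ^⊛` along `equiv_i`
  have h1 : PreFrobenioidData.OneUniqueSquare Ψ.functor (F₁.equiv.functor ⋙ Δ₁.modelBase)
      (F₂.equiv.functor ⋙ Δ₂.modelBase) B :=
    hB.of_equiv_top F₁.equiv F₂.equiv (T' := Ψ.functor) (F₁.equiv.funInvIdAssoc (Ψ.functor ⋙ F₂.equiv.functor))
  -- sides: `equiv_i ⋙ Base = toBase_i ⋙ identify_i` (`toBase_compat_i`)
  have h2 : PreFrobenioidData.OneUniqueSquare Ψ.functor (F₁.toBase ⋙ F₁.identify.functor)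
      (F₂.toBase ⋙ F₂.identify.functor) B :=
    h1.of_iso_sides F₁.toBase_compat.symm F₂.toBase_compat.symm
  -- bottom corners: back to `Base(ⁱℱ^⊛)` along `identify_i`
  have h3 := h2.of_equiv_bot F₁.identify.symm F₂.identify.symm
  exact ⟨F₁.identify.functor ⋙ B ⋙ F₂.identify.inverse,
    h3.of_iso_sides
      (Functor.associator F₁.toBase F₁.identify.functor F₁.identify.inverse ≪≫
        Functor.isoWhiskerLeft F₁.toBase F₁.identify.unitIso.symm ≪≫ F₁.toBase.rightUnitor)
      (Functor.associator F₂.toBase F₂.identify.functor F₂.identify.inverse ≪≫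
        Functor.isoWhiskerLeft F₂.toBase F₂.identify.unitIso.symm ≪≫ F₂.toBase.rightUnitor)⟩

/-- **`HasUnder` at the isomorphs**: under every `Ψ : ¹ℱ^⊛ ⥲ ²ℱ^⊛` lies an equivalence
`Base(¹ℱ^⊛) ⥲ Base(²ℱ^⊛)` — so abc-iut-L5-t4's natural map `CatIsomorphism.descend : Isom(¹ℱ^⊛, ²ℱ^⊛) →
Isom(Base(¹ℱ^⊛), Base(²ℱ^⊛))` of Cor. 5.3 (i) EXISTS here (same displayed hypotheses).
([IUTchI] Cor 5.3 (i) p.144) [claim: Mochizuki2012, status: disputed] -/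
theorem hasUnder_toBase (h₁ : ModelFrobenioid.Hypotheses Δ₁.Φ Δ₁.B) (h₂ : ModelFrobenioid.Hypotheses Δ₂.Φ Δ₂.B)
    (hpf₁ : Objectwise (fun M _ => IsPerfFactorial M) Δ₁.Φ) (hpf₂ : Objectwise (fun M _ => IsPerfFactorial M) Δ₂.Φ)
    (hsl₁ : IsSlim (BaseCat G₁)) (hsl₂ : IsSlim (BaseCat G₂))
    (hnd₁ : IsNonDilatingOn Δ₁.Φ) (hnd₂ : IsNonDilatingOn Δ₂.Φ)
    (hz₁ : ¬ ModelFrobenioid.IsZeroMonoid Δ₁.Φ) (hz₂ : ¬ ModelFrobenioid.IsZeroMonoid Δ₂.Φ) :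
    CatIsomorphism.HasUnder F₁.toBase F₂.toBase :=
  CatIsomorphism.hasUnder_of_forall_oneUniqueSquare
    (F₁.exists_oneUniqueSquare_toBase F₂ h₁ h₂ hpf₁ hpf₂ hsl₁ hsl₂ hnd₁ hnd₂ hz₁ hz₂)

/-- **`UnderUnique` at the isomorphs**: the equivalence `Base(¹ℱ^⊛) ⥲ Base(²ℱ^⊛)` under `Ψ` is unique up to
isomorphism — so `descend` is well defined and functorial (`descend_comp`, `descend_refl`, `descendHom`, BY NAME;
same displayed hypotheses). ([IUTchI] Cor 5.3 (i) p.144) [claim: Mochizuki2012, status: disputed] -/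
theorem underUnique_toBase (h₁ : ModelFrobenioid.Hypotheses Δ₁.Φ Δ₁.B)
    (h₂ : ModelFrobenioid.Hypotheses Δ₂.Φ Δ₂.B)
    (hpf₁ : Objectwise (fun M _ => IsPerfFactorial M) Δ₁.Φ) (hpf₂ : Objectwise (fun M _ => IsPerfFactorial M) Δ₂.Φ)
    (hsl₁ : IsSlim (BaseCat G₁)) (hsl₂ : IsSlim (BaseCat G₂))
    (hnd₁ : IsNonDilatingOn Δ₁.Φ) (hnd₂ : IsNonDilatingOn Δ₂.Φ)
    (hz₁ : ¬ ModelFrobenioid.IsZeroMonoid Δ₁.Φ) (hz₂ : ¬ ModelFrobenioid.IsZeroMonoid Δ₂.Φ) :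
    CatIsomorphism.UnderUnique F₁.toBase F₂.toBase :=
  CatIsomorphism.underUnique_of_forall_oneUniqueSquare
    (F₁.exists_oneUniqueSquare_toBase F₂ h₁ h₂ hpf₁ hpf₂ hsl₁ hsl₂ hnd₁ hnd₂ hz₁ hz₂)

end GlobalFrobenioid

end Literature.IUT.HodgeTheaters
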